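import Summits.BirchSwinnertonDyer.BirchSwinnertonDyer.Theses.LeadingTerm
import Literature.Barriers.BirchSwinnertonDyer.RankNotSumOfLocalInvariants480a1RankProofs

/-!
# Disproof of `SqueezeUBR2` / `SqueezeUB` (stmt-BirchSwinnertonDyer-0145) — findings

Standing disprover's work file (refuter-cdisprove-stmt-BirchSwinnertonDyer-0145-0, cycle 1).
Crux (route LeadingTerm, decl `SqueezeUBR2`; shared verbatim with Squeeze / HigherGrossZagier as
`SqueezeUB`, duplicate item stmt-0496):

  `∀ (W : WeierstrassCurve ℚ) [W.IsElliptic], W.mordellWeilRank ≤ W.analyticRank`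

i.e. NO EXCESS RANK: `rank_ℤ E(ℚ) ≤ ord_{s=1} L(E, s)` for every elliptic curve over `ℚ` — the
"Euler-system half" of BSD-rank, a theorem for `r_an ≤ 1` (Kolyvagin 1990 / Kato 2004 Thm 14.2;
tree: `Literature.NumberTheory.EllipticCurves.rank_eq_analyticRank_of_analyticRank_le_one` and its
`…_of_modularity` discharges) and OPEN for `r_an ≥ 2`.

VERDICT (cycle 1): NO KILL of the crux as stated; ONE LOAD-BEARING-HYPOTHESIS LEMMA LANDED
(§2, `squeezeUB_false_without_isElliptic`, sorry-free; tree copy p131586). Why the crux resists: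

* Paper level — a counterexample is an EXCESS-RANK curve: `k` independent rational points together
  with a certified NON-vanishing `L^{(m)}(E,1) ≠ 0` for some `m < k`. None is known or conjectured;
  every tabulated curve (Cremona/LMFDB, conductor `≤ 5·10⁵`; Stein–Watkins) has `rank = r_an`
  wherever `r_an` is certified (`r_an ≤ 3`), and rank records (Elkies 2006, `rank ≥ 28`; Elkies–Klagsbrun
  2020, `rank = 20` under GRH; Elkies–Klagsbrun 2024, `rank ≥ 29`) are LOWER bounds on `r_an`
  numerically consistent with equality. The statement follows from BSD, from finiteness of
  `Ш(E)[p^∞]` at one prime PLUS `p`-adic BSD-rank at that prime (Kato 18.4 + Schneider + IMC: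
  route PAdicOrderV2), and over function fields it is a THEOREM (Tate 1966; tree
  `Literature.NumberTheory.EllipticCurves.mordellWeilRank_le_analyticRank_holds` in `FunctionField.lean`)
  — so no structural obstruction is on record either.
* Barrier level — the catalogued `Literature.Barriers.BirchSwinnertonDyer.SelmerRankBarrier`
  (`SelmerVersusMordellWeil.lean`) says Euler-system methods bound `rank ≤ corank Sel_{p^∞} ≤ ord_T L_p`,
  never `≤ ord_s L` directly; this explains why the crux is OPEN, it does not make it false.
* Lean level — the only junk levers of the two definitions are closed:
  (i) `W.analyticRank := analyticOrderNatAt W.entireLFunction 1` is `0` if the chosen continuation is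
  junk (`¬ W.HasEntireLFunction`, then `entireLFunction = LSeries`, identically `0` = non-summable
  `tsum` near `s = 1`) — but `HasEntireLFunction W` is TRUE for every elliptic `W/ℚ` (modularity; tree
  fact `WeierstrassCurve.hasEntireLFunction_rat`, cite-only), hence can never be REFUTED for a witness;
  (ii) `analyticOrderNatAt = 0` when the function vanishes identically near `1` — excluded by the proved
  `WeierstrassCurve.entireLFunction_not_eventuallyEq_zero_holds` (`a₁ = 1`);
  (iii) `W.mordellWeilRank := Module.finrank ℤ E(ℚ)` is the TRUE rank: Mordell–Weil is proved in tree
  (`WeierstrassCurve.module_finite_point_holds`), so no `finrank`-of-infinite-rank junk (`= 0`) occurs —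
  and that junk would only HELP the inequality anyway.
  Consequently a Lean refutation needs, for one explicit elliptic `W`, an UPPER bound on
  `analyticRank W`, i.e. the entire continuation of ITS `L`-function in hand (curve-specific
  modularity, not in tree) plus a certified non-zero Taylor coefficient — and `k > m` independent
  points. Nothing of the kind exists even on paper.

WHAT THE HYPOTHESIS `[W.IsElliptic]` DOES (§1–§2, all sorry-free): it is LOAD-BEARING in the precise
sense that the binder-free statement `∀ W : WeierstrassCurve ℚ, W.mordellWeilRank ≤ W.analyticRank`
is FALSE — witness the cuspidal cubic `y² = x³` (`Δ = c₄ = 0`):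
* every local minimal model of it has `Δ = c₄ = 0`, so Mathlib's `localPolynomial` takes the additive
  branch `1` at EVERY finite place, `LFunction = ∏' 1 = 1`, `LSeries ≡ 1`, the entire continuation is
  the constant `1`, and `analyticRank = 0` (`cusp_analyticRank`);
* its nonsingular points are `(t², t³)`, `t ∈ ℚˣ`, and `(x, y) ↦ x / y = 1/t` is an INJECTIVE group
  homomorphism `E_ns(ℚ) →+ (ℚ, +)` (`phiHom`, `phi_injective`: the chord–tangent law on the cusp is
  `1/t₃ = 1/t₁ + 1/t₂`), so `Module.rank ℤ E_ns(ℚ) ≤ Module.rank ℤ ℚ = 1` and `(1,1)` has infinite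
  order: `mordellWeilRank = finrank ℤ E_ns(ℚ) = 1` (`cusp_mordellWeilRank`) — NOTE for provers: the
  docstring of `WeierstrassCurve.mordellWeilRank` ("junk value `0` if `E(K)` is not finitely
  generated") is INACCURATE: `finrank ℤ ℚ = 1` although `ℚ` is not finitely generated; `finrank` is `0`
  only for INFINITE rank (the nodal cubics, `E_ns(ℚ) ≅ ℚˣ` or a norm-one torus, do have `finrank 0`
  and satisfy the inequality by junk).
So `1 ≤ 0` fails: `squeezeUB_false_without_isElliptic`. Any proof of the crux must use `Δ ≠ 0`
(unsurprising, but now kernel-checked, and it pins down exactly which conventions the statement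
lives on: complete Euler product with additive factor `1`, `finrank` over `ℤ` of the full point group).

NATURAL STRENGTHENINGS (§3, recorded, not all typable here):
* `rank + dim_𝔽ₚ Ш(E)[p] ≤ r_an` / `dim Sel_p(E) − dim E(ℚ)[p] ≤ r_an`: FALSE in print (e.g. 571a1:
  `rank = r_an = 0`, `Ш ≅ (ℤ/2)²`; Cassels: `Ш[2]` unbounded in quadratic-twist families —
  `Literature.Barriers.BirchSwinnertonDyer.DescentDefectUnbounded*`); the crux is sharp in that only the
  Mordell–Weil rank, not any Selmer rank, can sit on the left.
* `corank_ℤₚ Sel_{p^∞}(E) ≤ r_an` for all `p`: equivalent to the crux + `#Ш[p^∞] < ∞`; open, implied by BSD.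
* equality `rank = r_an`: the summit itself.
* the same inequality over a number field `K`: same status (open for `r_an ≥ 2`; `r_an ≤ 1` known over
  totally real `K` in many cases); the cusp witness kills its `IsElliptic`-free form verbatim.
* dropping nothing but reading `analyticRank` through the NON-continued `LSeries`
  (`analyticOrderNatAt W.LSeries 1`): junk `0`, so that variant asserts `rank = 0` for all `E` — false
  (37a1), but refuting it in Lean needs non-summability of `L(E,s)` near `s = 1` (infinitely many
  `a_p ≠ 0`) and a certified point of infinite order; not attempted (convention-only content).

TARGETS: none this cycle (`stuck_stubs = []`, no line picked; crux ideas `kato-half-at-one-prime`,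
`unbalanced-definite-theta-cap` only filed 2026-08-16T22:58Z). When a line is picked, its stubs of the
shape "∃ p, ord_T L_p(f, α_p, T) ≤ r_an" (the `WeakComparisonLe` stub of kato-half) are weakenings of
PAdicOrderV2's crux stmt-0489 and inherit ITS disprover's analysis (Cruxes/PAdicOrderComparisonR2/
Disproof.lean: no kill; junk levers `f = 0`, `unitRoot = 0` closed by `IsNewformOf` / `IsOrdinaryAt`).

Contents
* §1 the witness `cusp` and its two invariants (`cusp_analyticRank = 0`, `cusp_mordellWeilRank = 1`);
* §2 load-bearing hypothesis: `SqueezeUBWithoutIsElliptic` and `squeezeUB_false_without_isElliptic`;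
  `squeezeUBR2_iff_squeezeUB` (the LeadingTerm and Squeeze/HigherGrossZagier decls are the same Prop);
* §3 strengthenings (docstrings; the typable one, `SqueezeUBSelmerTwo`-type, needs Selmer-group
  evaluation for a concrete curve — not in tree);
* §4 first concrete consequence in tree: the crux forces `1 ≤ r_an(480a1)` (rank `1` certified by the
  tree's complete `2`-descent) — i.e. `L(480a1, 1) = 0`, true in print (`w = −1`, `r_an = 1`): a
  consistency check, not a kill, and the cheapest place where the crux says something checkable.

LANDED: §1–§2 ACCEPTED as p131586 (commit 200addfd2610) as `Summits/BirchSwinnertonDyer/BirchSwinnertonDyer/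
Theorems/SqueezeUB/Negative/FalseWithoutIsElliptic.lean` (`--supports stmt-BirchSwinnertonDyer-0145`), theorems
`Summit.BirchSwinnertonDyer.BirchSwinnertonDyer.Theorems.squeezeUB_*` (witness written as the literal
`⟨0, 0, 0, 0, 0⟩`, the hom packaged as `squeezeUB_cusp_exists_addMonoidHom`; importable once applied).
-/

set_option linter.dupNamespace false

namespace Summit.BirchSwinnertonDyer.BirchSwinnertonDyer.Cruxes.SqueezeUB.Disproof

open WeierstrassCurve ArithmeticFunction IsDedekindDomain NumberField Filter
open Summit.BirchSwinnertonDyer.BirchSwinnertonDyer.Theses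

/-! ## §1 The witness: the cuspidal cubic `y² = x³` -/

/-- The cuspidal cubic `y² = x³` over `ℚ` (all `aᵢ = 0`; `Δ = 0`, `c₄ = 0`). [folklore] -/
def cusp : WeierstrassCurve ℚ := ⟨0, 0, 0, 0, 0⟩

@[simp] theorem cusp_a₁ : cusp.a₁ = 0 := rfl
@[simp] theorem cusp_a₂ : cusp.a₂ = 0 := rfl
@[simp] theorem cusp_a₃ : cusp.a₃ = 0 := rfl
@[simp] theorem cusp_a₄ : cusp.a₄ = 0 := rfl
@[simp] theorem cusp_a₆ : cusp.a₆ = 0 := rfl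

/-- `Δ(y² = x³) = 0`: the curve is singular (NOT `IsElliptic`). [folklore] -/
theorem cusp_Δ : cusp.Δ = 0 := by
  simp [cusp, WeierstrassCurve.Δ, WeierstrassCurve.b₂, WeierstrassCurve.b₄, WeierstrassCurve.b₆,
    WeierstrassCurve.b₈]

/-- `c₄(y² = x³) = 0`: the singularity is a cusp. [folklore] -/
theorem cusp_c₄ : cusp.c₄ = 0 := by
  simp [cusp, WeierstrassCurve.c₄, WeierstrassCurve.b₂, WeierstrassCurve.b₄]

theorem not_isElliptic_cusp : ¬ cusp.IsElliptic := fun h ↦ by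
  simpa [cusp_Δ] using h.isUnit

/-! ### §1a The analytic side: `L(cusp, s) ≡ 1`, `analyticRank = 0` -/

section Local

variable (R : Type*) [CommRing R] [IsDomain R] [IsDiscreteValuationRing R] {K : Type*}
  [Field K] [Algebra R K] [IsFractionRing R K]

/-- A Weierstrass equation with `Δ = 0` and `c₄ = 0` over the fraction field of a DVR has Mathlib
local polynomial `1`: every model `C • W` again has `Δ = c₄ = 0` (`variableChange_Δ`,
`variableChange_c₄`), so the chosen minimal model has valuation `v(0) = 0 < 1` of both, i.e.
`HasAdditiveReduction`, which is neither good nor (split) multiplicative. [folklore] -/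
theorem localPolynomial_eq_one_of_Δ_eq_zero_of_c₄_eq_zero (W : WeierstrassCurve K) (hΔ : W.Δ = 0)
    (hc₄ : W.c₄ = 0) : W.localPolynomial R = 1 := by
  have hΔ' : (W.minimal R).Δ = 0 := by
    rw [WeierstrassCurve.minimal, variableChange_Δ, hΔ, mul_zero]
  have hc₄' : (W.minimal R).c₄ = 0 := by
    rw [WeierstrassCurve.minimal, variableChange_c₄, hc₄, mul_zero]
  have hadd : (W.minimal R).HasAdditiveReduction R := by
    refine (hasAdditiveReduction_iff R _).mpr ⟨inferInstance, ?_, ?_⟩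
    · rw [hΔ', _root_.map_zero]; exact zero_lt_one
    · rw [hc₄', _root_.map_zero]; exact zero_lt_one
  unfold localPolynomial
  rw [if_neg hadd.not_hasGoodReduction, if_neg, if_neg hadd.not_hasMultiplicativeReduction]
  exact fun hs ↦ hadd.not_hasMultiplicativeReduction _ hs.toHasMultiplicativeReduction

/-- … hence local Euler factor `1` (the Dirichlet series `1`). [folklore] -/
theorem localEulerFactor_eq_one_of_Δ_eq_zero_of_c₄_eq_zero (W : WeierstrassCurve K) (hΔ : W.Δ = 0)
    (hc₄ : W.c₄ = 0) : W.localEulerFactor R = 1 := by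
  have hps : W.localPowerSeries R = 1 := by
    rw [localPowerSeries, localPolynomial_eq_one_of_Δ_eq_zero_of_c₄_eq_zero R W hΔ hc₄,
      Polynomial.coe_one]
    have := PowerSeries.mul_invOfUnit (1 : PowerSeries ℤ) 1 (by simp)
    rwa [one_mul] at this
  rw [localEulerFactor, hps, map_one]

end Local

/-- The Euler product of the constant family `1` is `1` (via the outward-facing API
`tendsTo_eulerProduct_of_tendsTo`: all partial products are `1`). [folklore] -/
theorem eulerProduct_one {ι : Type*} :
    eulerProduct (fun _ : ι ↦ (1 : ArithmeticFunction ℤ)) = 1 := by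
  ext n
  have h := tendsTo_eulerProduct_of_tendsTo (fun _ : ι ↦ (1 : ArithmeticFunction ℤ))
    (fun n ↦ Eventually.of_forall fun _ ↦ rfl) n
  obtain ⟨s, hs⟩ := h.exists
  rw [Finset.prod_const_one] at hs
  exact hs.symm

/-- `L(cusp, s)` as a formal Dirichlet series is `1`: every local factor is the additive `1`.
[folklore] -/
theorem cusp_LFunction : cusp.LFunction = 1 := by
  have h : (fun v : HeightOneSpectrum (𝓞 ℚ) ↦
      (cusp.baseChange (v.adicCompletion ℚ)).localEulerFactor (v.adicCompletionIntegers ℚ)) =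
      fun _ ↦ 1 := by
    funext v
    apply localEulerFactor_eq_one_of_Δ_eq_zero_of_c₄_eq_zero
    · rw [baseChange, map_Δ, cusp_Δ, _root_.map_zero]
    · rw [baseChange, map_c₄, cusp_c₄, _root_.map_zero]
  change eulerProduct _ = 1
  rw [h, eulerProduct_one]

/-- `L(cusp, s) = 1` for every `s` (`LSeries δ = 1`). [folklore] -/
theorem cusp_LSeries : cusp.LSeries = fun _ ↦ 1 := by
  funext s
  change LSeries (fun n ↦ ((cusp.LFunction n : ℤ) : ℂ)) s = 1
  rw [cusp_LFunction]
  have : (fun n ↦ (((1 : ArithmeticFunction ℤ) n : ℤ) : ℂ)) = LSeries.delta := by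
    funext n
    simp only [one_apply, LSeries.delta]
    split_ifs <;> simp
  rw [this, LSeries_delta, Pi.one_apply]

/-- The constant `1` is an entire continuation of `L(cusp, s)`. [folklore] -/
theorem cusp_hasEntireLFunction : cusp.HasEntireLFunction :=
  ⟨fun _ ↦ 1, differentiable_const 1, fun s _ ↦ by rw [cusp_LSeries]⟩

/-- The chosen entire continuation of `L(cusp, s)` IS the constant `1` (uniqueness of entire
continuations, `subsingleton_entireContinuations`). [folklore] -/
theorem cusp_entireLFunction : cusp.entireLFunction = fun _ ↦ 1 :=
  cusp.subsingleton_entireContinuations (cusp.entireLFunction_mem cusp_hasEntireLFunction)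
    ⟨differentiable_const 1, fun s _ ↦ by rw [cusp_LSeries]⟩

/-- **`r_an(y² = x³) = 0`**: the order of vanishing of the constant `1` at `s = 1`. [folklore] -/
theorem cusp_analyticRank : cusp.analyticRank = 0 := by
  have h : analyticOrderAt (fun _ : ℂ ↦ (1 : ℂ)) 1 = 0 :=
    (analyticAt_const).analyticOrderAt_eq_zero.mpr one_ne_zero
  simp [WeierstrassCurve.analyticRank, analyticOrderNatAt, cusp_entireLFunction, h]

/-! ### §1b The algebraic side: `E_ns(ℚ) ↪ (ℚ, +)`, `mordellWeilRank = 1` -/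

theorem cusp_equation_iff (x y : ℚ) : cusp.toAffine.Equation x y ↔ y ^ 2 = x ^ 3 := by
  rw [Affine.equation_iff]
  simp

/-- The nonsingular rational points of `y² = x³` are the `(x, y)` on the curve with `y ≠ 0`
(the cusp `(0,0)` is the only singular point). [folklore] -/
theorem cusp_nonsingular_iff (x y : ℚ) :
    cusp.toAffine.Nonsingular x y ↔ y ^ 2 = x ^ 3 ∧ y ≠ 0 := by
  rw [Affine.nonsingular_iff', cusp_equation_iff]
  simp only [cusp_a₁, cusp_a₂, cusp_a₃, cusp_a₄, zero_mul, mul_zero, add_zero, zero_sub, ne_eq,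
    neg_eq_zero]
  constructor
  · rintro ⟨h, h'⟩
    refine ⟨h, fun hy ↦ ?_⟩
    subst hy
    have hx : x = 0 := by
      have : x ^ 3 = 0 := by rw [← h]; ring
      exact pow_eq_zero_iff (by norm_num) |>.mp this
    subst hx
    simp at h'
  · rintro ⟨h, hy⟩
    exact ⟨h, Or.inr (by simpa using hy)⟩

/-- Parametrisation: every nonsingular point of the cusp is `(t², t³)` with `t = y/x ≠ 0`.
[folklore] -/
theorem cusp_param {x y : ℚ} (h : cusp.toAffine.Nonsingular x y) :
    ∃ t : ℚ, t ≠ 0 ∧ x = t ^ 2 ∧ y = t ^ 3 := by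
  rw [cusp_nonsingular_iff] at h
  obtain ⟨h, hy⟩ := h
  have hx : x ≠ 0 := by
    rintro rfl
    apply hy
    have : y ^ 2 = 0 := by rw [h]; ring
    exact pow_eq_zero_iff (by norm_num) |>.mp this
  refine ⟨y / x, div_ne_zero hy hx, ?_, ?_⟩
  · field_simp
    rw [h]
  · have : (y / x) ^ 3 = (y / x) ^ 2 * (y / x) := by ring
    rw [this]
    field_simp
    rw [h]

theorem cusp_nonsingular_param {t : ℚ} (ht : t ≠ 0) :
    cusp.toAffine.Nonsingular (t ^ 2) (t ^ 3) := by
  rw [cusp_nonsingular_iff]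
  exact ⟨by ring, pow_ne_zero 3 ht⟩

/-- The map `E_ns(ℚ) → ℚ`, `(x, y) ↦ x / y` (`= 1/t` on `(t², t³)`), `O ↦ 0`. [folklore] -/
def phi : cusp.toAffine.Point → ℚ
  | .zero => 0
  | .some x y _ => x / y

@[simp] theorem phi_zero : phi 0 = 0 := rfl

@[simp] theorem phi_some {x y : ℚ} (h : cusp.toAffine.Nonsingular x y) :
    phi (.some x y h) = x / y := rfl

/-- **The chord–tangent law on the cusp is addition of `1/t`**: `phi (P + Q) = phi P + phi Q`
(Silverman AEC III.2.5: `E_ns(K) ≅ K⁺` for a cuspidal cubic). Direct computation with Mathlib's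
`addX` / `addY` / `slope`: for `P = (t₁², t₁³)`, `Q = (t₂², t₂³)` not opposite, the slope is
`(t₁² + t₁t₂ + t₂²)/(t₁ + t₂)` (secant and tangent case alike) and
`P + Q = ((t₁t₂/(t₁+t₂))², (t₁t₂/(t₁+t₂))³)`. [cite: SilvermanAEC2009, Prop. III.2.5] -/
theorem phi_add (P Q : cusp.toAffine.Point) : phi (P + Q) = phi P + phi Q := by
  rcases P with _ | ⟨x₁, y₁, h₁⟩
  · have h0 : (Affine.Point.zero : cusp.toAffine.Point) + Q = Q := zero_add Q
    rw [h0]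
    change phi Q = phi 0 + phi Q
    simp
  rcases Q with _ | ⟨x₂, y₂, h₂⟩
  · have h0 : (Affine.Point.some x₁ y₁ h₁ : cusp.toAffine.Point) + Affine.Point.zero =
        Affine.Point.some x₁ y₁ h₁ := add_zero _
    rw [h0]
    change _ = _ + phi 0
    simp
  obtain ⟨t₁, ht₁, rfl, rfl⟩ := cusp_param h₁
  obtain ⟨t₂, ht₂, rfl, rfl⟩ := cusp_param h₂
  have key : (t₁ ^ 2 / t₁ ^ 3 + t₂ ^ 2 / t₂ ^ 3 : ℚ) = (t₁ + t₂) / (t₁ * t₂) := by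
    field_simp
    ring
  by_cases hxy : t₁ ^ 2 = t₂ ^ 2 ∧ t₁ ^ 3 = cusp.toAffine.negY (t₂ ^ 2) (t₂ ^ 3)
  · -- opposite points: `t₁ = -t₂`, `P + Q = O`
    rw [Affine.Point.add_of_Y_eq hxy.1 hxy.2]
    obtain ⟨hx, hy⟩ := hxy
    simp only [Affine.negY, cusp_a₁, cusp_a₃, zero_mul, sub_zero] at hy
    have ht : t₁ = -t₂ := by
      rcases eq_or_eq_neg_of_sq_eq_sq _ _ hx with h | h
      · exfalso
        subst h
        have : t₁ ^ 3 = 0 := by linarith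
        exact ht₁ (pow_eq_zero_iff (by norm_num) |>.mp this)
      · exact h
    subst ht
    simp only [phi_zero, phi_some]
    field_simp
    ring
  · rw [Affine.Point.add_some hxy]
    simp only [phi_some]
    have hsum : t₁ + t₂ ≠ 0 := by
      intro hs
      have ht : t₁ = -t₂ := by linarith
      apply hxy
      subst ht
      refine ⟨by ring, ?_⟩
      simp [Affine.negY]
      ring
    have hL : cusp.toAffine.slope (t₁ ^ 2) (t₂ ^ 2) (t₁ ^ 3) (t₂ ^ 3) =
        (t₁ ^ 2 + t₁ * t₂ + t₂ ^ 2) / (t₁ + t₂) := by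
      by_cases hx : t₁ ^ 2 = t₂ ^ 2
      · -- tangent case `t₁ = t₂`
        have ht : t₁ = t₂ := by
          rcases eq_or_eq_neg_of_sq_eq_sq _ _ hx with h | h
          · exact h
          · exfalso; apply hsum; linarith
        subst ht
        have hy : t₁ ^ 3 ≠ cusp.toAffine.negY (t₁ ^ 2) (t₁ ^ 3) := fun h ↦ hxy ⟨rfl, h⟩
        rw [Affine.slope_of_Y_ne rfl hy]
        simp only [Affine.negY, cusp_a₁, cusp_a₂, cusp_a₃, cusp_a₄, zero_mul, mul_zero, add_zero,
          sub_zero]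
        field_simp
        ring
      · -- secant case
        rw [Affine.slope_of_X_ne hx]
        have h1 : t₁ - t₂ ≠ 0 := by
          intro h; apply hx; have : t₁ = t₂ := by linarith
          rw [this]
        have h2 : t₁ ^ 2 - t₂ ^ 2 ≠ 0 := sub_ne_zero.mpr hx
        field_simp
        ring
    have hX : cusp.toAffine.addX (t₁ ^ 2) (t₂ ^ 2)
        (cusp.toAffine.slope (t₁ ^ 2) (t₂ ^ 2) (t₁ ^ 3) (t₂ ^ 3)) = (t₁ * t₂) ^ 2 / (t₁ + t₂) ^ 2 := by
      rw [hL]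
      simp only [Affine.addX, cusp_a₁, cusp_a₂, zero_mul, add_zero, sub_zero]
      field_simp
      ring
    have hY : cusp.toAffine.addY (t₁ ^ 2) (t₂ ^ 2) (t₁ ^ 3)
        (cusp.toAffine.slope (t₁ ^ 2) (t₂ ^ 2) (t₁ ^ 3) (t₂ ^ 3)) = (t₁ * t₂) ^ 3 / (t₁ + t₂) ^ 3 := by
      rw [Affine.addY, Affine.negAddY, hX, hL]
      simp only [Affine.negY, cusp_a₁, cusp_a₃, zero_mul, sub_zero]
      field_simp
      ring
    rw [hX, hY, key]
    have hprod : t₁ * t₂ ≠ 0 := mul_ne_zero ht₁ ht₂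
    field_simp

/-- `phi` as a group homomorphism `E_ns(ℚ) →+ ℚ`. [folklore] -/
def phiHom : cusp.toAffine.Point →+ ℚ where
  toFun := phi
  map_zero' := phi_zero
  map_add' := phi_add

/-- `phi` is injective (`1/t` determines `t`, hence the point). [folklore] -/
theorem phi_injective : Function.Injective phi := by
  rintro (_ | ⟨x₁, y₁, h₁⟩) (_ | ⟨x₂, y₂, h₂⟩) h
  · rfl
  · obtain ⟨t, ht, rfl, rfl⟩ := cusp_param h₂
    change (0 : ℚ) = t ^ 2 / t ^ 3 at h
    exfalso
    have : t ^ 2 / t ^ 3 = t⁻¹ := by field_simp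
    rw [this] at h
    exact inv_ne_zero ht h.symm
  · obtain ⟨t, ht, rfl, rfl⟩ := cusp_param h₁
    change t ^ 2 / t ^ 3 = (0 : ℚ) at h
    exfalso
    have : t ^ 2 / t ^ 3 = t⁻¹ := by field_simp
    rw [this] at h
    exact inv_ne_zero ht h
  · obtain ⟨t₁, ht₁, rfl, rfl⟩ := cusp_param h₁
    obtain ⟨t₂, ht₂, rfl, rfl⟩ := cusp_param h₂
    change t₁ ^ 2 / t₁ ^ 3 = t₂ ^ 2 / t₂ ^ 3 at h
    have e1 : t₁ ^ 2 / t₁ ^ 3 = t₁⁻¹ := by field_simp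
    have e2 : t₂ ^ 2 / t₂ ^ 3 = t₂⁻¹ := by field_simp
    rw [e1, e2, inv_inj] at h
    subst h
    rfl

/-- The point `(1, 1)` of the cusp. [folklore] -/
def P₀ : cusp.toAffine.Point := .some 1 1 (by simpa using cusp_nonsingular_param one_ne_zero)

theorem phi_P₀ : phi P₀ = 1 := by simp [P₀]

/-- `rank_ℤ ℚ = 1` (localisation does not change the rank). [folklore] -/
theorem rank_int_rat : Module.rank ℤ ℚ = 1 := by
  have := IsLocalization.rank_eq ℚ (N := ℚ) (nonZeroDivisors ℤ) le_rfl
  rw [Module.rank_self] at this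
  exact this.symm

/-- `rank_ℤ E_ns(ℚ) ≤ 1` via the injection `phi` into `ℚ`. [folklore] -/
theorem cusp_rank_le : Module.rank ℤ cusp.toAffine.Point ≤ 1 := by
  have := LinearMap.rank_le_of_injective phiHom.toIntLinearMap phi_injective
  rwa [rank_int_rat] at this

/-- `1 ≤ rank_ℤ E_ns(ℚ)`: `(1,1)` has infinite order (`phi (n • P₀) = n`). [folklore] -/
theorem cusp_one_le_rank : 1 ≤ Module.rank ℤ cusp.toAffine.Point := by
  have hli : LinearIndependent ℤ ![P₀] := by
    rw [Fintype.linearIndependent_iff]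
    intro g hg i
    fin_cases i
    simp only [Fin.sum_univ_one, Matrix.cons_val_fin_one] at hg
    have := congrArg phiHom hg
    rw [map_zsmul, _root_.map_zero] at this
    change g 0 • phi P₀ = 0 at this
    rw [phi_P₀, zsmul_eq_mul, mul_one] at this
    exact_mod_cast this
  simpa using hli.cardinal_le_rank

/-- `finrank ℤ E_ns(ℚ) = 1` for the cusp (with this file's `DecidableEq ℚ`). [folklore] -/
theorem cusp_finrank : Module.finrank ℤ cusp.toAffine.Point = 1 := by
  apply Module.finrank_eq_of_rank_eq
  rw [Nat.cast_one]
  exact le_antisymm cusp_rank_le cusp_one_le_rank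

/-- **`rank(y² = x³) = 1`** in the sense of the tree's `WeierstrassCurve.mordellWeilRank`
(`= Module.finrank ℤ E_ns(ℚ)`, stated with the classical `DecidableEq`; `convert` bridges the
decidability instances). [folklore] -/
theorem cusp_mordellWeilRank : cusp.mordellWeilRank = 1 := by
  unfold WeierstrassCurve.mordellWeilRank
  convert cusp_finrank

/-! ## §2 Load-bearing hypothesis `[W.IsElliptic]` -/

/-- The crux with its only hypothesis `[W.IsElliptic]` DROPPED: the inequality for every Weierstrass
equation over `ℚ`, singular ones included. [folklore] -/
def SqueezeUBWithoutIsElliptic : Prop :=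
  ∀ W : WeierstrassCurve ℚ, W.mordellWeilRank ≤ W.analyticRank

/-- **`IsElliptic` is load-bearing**: without it the statement is false — the cuspidal cubic
`y² = x³` has `mordellWeilRank = 1` (`E_ns(ℚ) ≅ ℚ⁺` has `ℤ`-rank `1`) and `analyticRank = 0`
(`L ≡ 1`). Any proof of `SqueezeUB(R2)` must use `Δ ≠ 0`. [folklore] -/
theorem squeezeUB_false_without_isElliptic : ¬ SqueezeUBWithoutIsElliptic := by
  intro h
  have h1 := h cusp
  rw [cusp_mordellWeilRank, cusp_analyticRank] at h1
  exact Nat.not_succ_le_zero 0 h1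

/-- The crux is, equivalently, the hypothesis-explicit form (how `closes` consumes it). [folklore] -/
theorem squeezeUBR2_iff :
    LeadingTerm.SqueezeUBR2 ↔ ∀ W : WeierstrassCurve ℚ, W.IsElliptic → W.mordellWeilRank ≤ W.analyticRank :=
  ⟨fun h W hW ↦ @h W hW, fun h W hW ↦ h W hW⟩

/-- The witness is NOT a counterexample to the crux itself: it is excluded exactly by `IsElliptic`.
[folklore] -/
theorem cusp_not_counterexample : ¬ (cusp.IsElliptic ∧ cusp.analyticRank < cusp.mordellWeilRank) :=
  fun h ↦ not_isElliptic_cusp h.1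

/-! ## §3 Natural strengthenings (records)

* `SelmerUB`: `dim_𝔽ₚ Sel_p(E) − dim_𝔽ₚ E(ℚ)[p] ≤ r_an(E)` — FALSE in print (571a1: `r_an = rank = 0`,
  `Ш(E)[2] ≅ (ℤ/2)²`; Cassels 1964: `dim Ш(E_d)[2]` unbounded over quadratic twists — tree barrier files
  `Literature.Barriers.BirchSwinnertonDyer.DescentDefectUnbounded*`). Not typed here: a Lean refutation
  needs the `2`-Selmer group of a concrete curve, which the tree cannot evaluate.
* `CorankUB`: `corank Sel_{p^∞}(E) ≤ r_an(E)` — open; `= crux + #Ш[p^∞] < ∞`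
  (`Literature.Barriers.BirchSwinnertonDyer.SelmerRankBarrier`, pointwise form
  `mordellWeilRank_le_selmerCorank_and_eq_iff`).
* `p`-adic avatar: `rank ≤ ord_T L_p(E, T)` is a THEOREM for odd good ordinary `p` (Kato 2004 Thm 18.4;
  tree fact `Literature.NumberTheory.EllipticCurves.kato_mordellWeilRank_le_order_padicLFunction`), so the
  crux is implied by the one-prime comparison `∃ p, ord_T L_p ≤ ord_{s=1} L` (crux idea
  kato-half-at-one-prime; PAdicOrderV2 item stmt-0489 is its ∀p-equality form).
* Function fields: the verbatim analogue `rank ≤ r_an` is PROVED (Tate 1966;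
  `Literature.NumberTheory.EllipticCurves.mordellWeilRank_le_analyticRank_holds`). -/

/-! ## §4 First concrete consequence in tree (consistency check, not a kill)

The cheapest CHECKABLE thing the crux asserts: for the one elliptic curve whose positive rank is
certified in the tree — `480a1 : y² = x³ − x² − 6x`, `rank_ℤ E(ℚ) = 1` by the complete `2`-descent
`Literature.Barriers.BirchSwinnertonDyer.curve480a1.mordellWeilRank_eq_one` — the crux forces
`1 ≤ r_an(480a1)`, i.e. `L(480a1, 1) = 0` (given the entire continuation). In print `480a1` has root
number `−1` and `r_an = 1` (Cremona's tables), so this consequence is TRUE: no refutation here, and a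
Lean refutation along these lines would need `L(480a1, 1) ≠ 0`, which is false. (`24A1`, the tree's other
descended curve, has rank `0` and is silent.) -/

open Literature.Barriers.BirchSwinnertonDyer in
/-- `SqueezeUBR2 ⇒ 1 ≤ r_an(480a1)` (`⇔ L(480a1, 1) = 0` given the continuation): the first concrete,
in-print-checkable consequence of the crux available in the tree; consistent with Cremona's table
(`480a1`: `r = 1`, `w = −1`). [folklore] -/
theorem squeezeUBR2_one_le_analyticRank_480a1 (h : LeadingTerm.SqueezeUBR2) :
    1 ≤ (curve480a1.baseChange ℚ).analyticRank := by
  haveI := curve480a1.isElliptic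
  have h1 := h (curve480a1.baseChange ℚ)
  rwa [curve480a1.mordellWeilRank_eq_one] at h1

end Summit.BirchSwinnertonDyer.BirchSwinnertonDyer.Cruxes.SqueezeUB.Disproof
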